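import Mathlib
import Summits.NavierStokesRegularity.NavierStokesRegularity.Theses.SlicedKelvin

/-!
# Crux `SlicedKelvin.FluxZoom` (stmt-NavierStokesRegularity-15603), line `registered`,
# stub `stub_fderivLimit`: pointwise convergence of derivatives under locally uniform
# convergence and a uniform `C²` bound

Support file (theorems only, `--supports stmt-NavierStokesRegularity-15603`) for the lead's
skeleton of the crux `FluxZoom` of route `SlicedKelvin`. If `f_j → g` locally uniformly on `ℝ³`,
the `f_j` (eventually) and `g` are `C²` with second derivatives bounded in operator norm by `C`,
then `Df_j(x) → Dg(x)` for every `x` (Landau–Kolmogorov interpolation at a point). In the crux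
this passes the vorticity of the rescaled velocity fields to the blow-up limit.

## Proof

Pure calculus. For a `C²` map `F` with `‖D²F‖ ≤ M` two mean value inequalities
(`Convex.norm_image_sub_le_of_norm_fderiv_le`) give the second-order Taylor remainder
`‖F(x+h) − F(x) − DF(x)h‖ ≤ M‖h‖²` (`norm_taylor_two_sub_le`: first `DF` is `M`-Lipschitz, then
the map `y ↦ F y − DF(x) y` has derivative `DF(y) − DF(x)`, of norm `≤ M‖h‖` on the ball
`closedBall x ‖h‖`). Applied to `f_j` and to `g` this yields
`‖(Df_j(x) − Dg(x)) h‖ ≤ ‖(f_j − g)(x+h)‖ + ‖(f_j − g)(x)‖ + 2C‖h‖²`.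
Given `ε > 0` choose `0 < η ≤ 1` with `2Cη ≤ ε/4`; locally uniform convergence on the locally
compact space `ℝ³` is uniform convergence on the compact ball `closedBall x 1`
(`tendstoLocallyUniformly_iff_forall_isCompact`), so eventually `‖f_j − g‖ < εη/4` there; with
`h = ηe`, `‖e‖ = 1`, this gives `‖(Df_j(x) − Dg(x)) e‖ ≤ ε/2 + 2Cη < ε`, whence the operator
norm bound (`ContinuousLinearMap.opNorm_le_of_unit_norm`).

No named fact is assumed: every ingredient is a theorem of Mathlib.

## References

* G. Koch, N. Nadirashvili, G. Seregin, V. Šverák, *Liouville theorems for the Navier–Stokes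
  equations and applications*, Acta Math. 203 (2009) = arXiv:0709.3599, Lemma 6.1
  [KochNadirashviliSereginSverak2009].
-/

noncomputable section

-- the summit and its single sub-problem share the name (CONVENTIONS §1), as in every Theorems file
set_option linter.dupNamespace false

open Set Filter Topology Metric

namespace Summit.NavierStokesRegularity.NavierStokesRegularity.Theorems.FluxZoom.Registered

/-- **Second-order Taylor remainder from a bound on the second derivative.** If `F` is `C²` on a
real normed space with `‖D²F(z)‖ ≤ M` for all `z`, then `‖F(x+h) − F(x) − DF(x)h‖ ≤ M‖h‖‖h‖`
(two applications of the mean value inequality `Convex.norm_image_sub_le_of_norm_fderiv_le`). -/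
theorem norm_taylor_two_sub_le {E G : Type*} [NormedAddCommGroup E] [NormedSpace ℝ E]
    [NormedAddCommGroup G] [NormedSpace ℝ G] {F : E → G} {M : ℝ} (hF : ContDiff ℝ 2 F)
    (hM : ∀ z, ‖iteratedFDeriv ℝ 2 F z‖ ≤ M) (x h : E) :
    ‖F (x + h) - F x - fderiv ℝ F x h‖ ≤ M * ‖h‖ * ‖h‖ := by
  have hd1 : Differentiable ℝ F := hF.differentiable (by simp)
  have hd2 : Differentiable ℝ (fderiv ℝ F) :=
    (hF.fderiv_right (m := 1) (by norm_num)).differentiable (by simp)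
  have hn2 : ∀ z, ‖fderiv ℝ (fderiv ℝ F) z‖ ≤ M := fun z => by
    rw [← norm_iteratedFDeriv_zero (𝕜 := ℝ) (f := fderiv ℝ (fderiv ℝ F)) (x := z),
      norm_iteratedFDeriv_fderiv, norm_iteratedFDeriv_fderiv]
    exact hM z
  have hM0 : 0 ≤ M := (norm_nonneg _).trans (hM x)
  -- first mean value inequality: `DF` is `M`-Lipschitz
  have hlip : ∀ y, ‖fderiv ℝ F y - fderiv ℝ F x‖ ≤ M * ‖y - x‖ := fun y =>
    convex_univ.norm_image_sub_le_of_norm_fderiv_le (fun z _ => hd2 z) (fun z _ => hn2 z)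
      (mem_univ x) (mem_univ y)
  -- second mean value inequality, for `y ↦ F y − DF(x) y` on the ball `closedBall x ‖h‖`
  set L : E →L[ℝ] G := fderiv ℝ F x with hL
  have hφ : ∀ y, HasFDerivAt (fun y => F y - L y) (fderiv ℝ F y - L) y := fun y =>
    (hd1 y).hasFDerivAt.sub L.hasFDerivAt
  have hbound : ∀ y ∈ closedBall x ‖h‖, ‖fderiv ℝ (fun y => F y - L y) y‖ ≤ M * ‖h‖ := by
    intro y hy
    rw [(hφ y).fderiv]
    exact (hlip y).trans (mul_le_mul_of_nonneg_left (mem_closedBall_iff_norm.1 hy) hM0)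
  have hmv := (convex_closedBall x ‖h‖).norm_image_sub_le_of_norm_fderiv_le
    (fun y _ => (hφ y).differentiableAt) hbound (mem_closedBall_self (norm_nonneg h))
    (add_mem_closedBall_iff_norm.2 le_rfl)
  rw [add_sub_cancel_left] at hmv
  have hid : F (x + h) - F x - L h = (F (x + h) - L (x + h)) - (F x - L x) := by
    rw [map_add]; abel
  rw [hid]
  exact hmv

/-- **Stub `stub_fderivLimit` of the crux `SlicedKelvin.FluxZoom`, line `registered`.** If
`f_j → g` locally uniformly on `ℝ³`, the `f_j` (eventually) and `g` are `C²` with second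
derivatives bounded by `C`, then `Df_j(x) → Dg(x)` for every `x` (Landau–Kolmogorov at a point:
`‖(Df_j(x) − Dg(x)) h‖ ≤ ‖(f_j − g)(x+h)‖ + ‖(f_j − g)(x)‖ + 2C‖h‖²` by `norm_taylor_two_sub_le`,
then `h = ηe` with `η → 0` slowly). Unconditional: no named fact is taken as a hypothesis. -/
theorem stub_fderivLimit :
    ∀ (C : ℝ) (f : ℕ → EuclideanSpace ℝ (Fin 3) → EuclideanSpace ℝ (Fin 3))
      (g : EuclideanSpace ℝ (Fin 3) → EuclideanSpace ℝ (Fin 3)) (x : EuclideanSpace ℝ (Fin 3)),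
      (∀ᶠ j in Filter.atTop, ContDiff ℝ 2 (f j) ∧ ∀ y, ‖iteratedFDeriv ℝ 2 (f j) y‖ ≤ C) →
      ContDiff ℝ 2 g → (∀ y, ‖iteratedFDeriv ℝ 2 g y‖ ≤ C) →
      TendstoLocallyUniformly f g Filter.atTop →
      Filter.Tendsto (fun j => fderiv ℝ (f j) x) Filter.atTop (nhds (fderiv ℝ g x)) := by
  intro C f g x hf hg hgC hloc
  have hC : 0 ≤ C := (norm_nonneg _).trans (hgC x)
  -- locally uniform convergence on `ℝ³` is uniform convergence on the compact ball `closedBall x 1`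
  have hU : TendstoUniformlyOn f g atTop (closedBall x 1) :=
    (tendstoLocallyUniformly_iff_forall_isCompact.1 hloc) _ (isCompact_closedBall x 1)
  rw [Metric.tendstoUniformlyOn_iff] at hU
  rw [Metric.tendsto_nhds]
  intro ε hε
  -- the step `η`: `0 < η ≤ 1` and `2Cη ≤ ε/4`
  obtain ⟨η, hη0, hη1, hCη⟩ : ∃ η : ℝ, 0 < η ∧ η ≤ 1 ∧ 2 * C * η ≤ ε / 4 := by
    refine ⟨min 1 (ε / (8 * (C + 1))), lt_min one_pos (by positivity), min_le_left _ _, ?_⟩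
    calc 2 * C * min 1 (ε / (8 * (C + 1))) ≤ 2 * (C + 1) * (ε / (8 * (C + 1))) := by
          gcongr
          · linarith
          · exact min_le_right _ _
      _ = ε / 4 := by field_simp; ring
  -- eventually `‖f_j − g‖ < εη/4` on the ball, and `f_j` is `C²` with `‖D²f_j‖ ≤ C`
  have hδ0 : 0 < ε * η / 4 := by positivity
  filter_upwards [hf, hU _ hδ0] with j hfj hUj
  rw [dist_eq_norm]
  -- the bound on unit vectors
  have key : ∀ e : EuclideanSpace ℝ (Fin 3), ‖e‖ = 1 →
      ‖(fderiv ℝ (f j) x - fderiv ℝ g x) e‖ ≤ ε / 2 + 2 * C * η := by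
    intro e he
    set h : EuclideanSpace ℝ (Fin 3) := η • e with hh
    have hnh : ‖h‖ = η := by rw [hh, norm_smul, he, mul_one, Real.norm_of_nonneg hη0.le]
    have h1 := norm_taylor_two_sub_le hfj.1 hfj.2 x h
    have h2 := norm_taylor_two_sub_le hg hgC x h
    have h3 : ‖f j (x + h) - g (x + h)‖ ≤ ε * η / 4 := by
      rw [← dist_eq_norm, dist_comm]
      exact (hUj _ (add_mem_closedBall_iff_norm.2 (hnh.le.trans hη1))).le
    have h4 : ‖f j x - g x‖ ≤ ε * η / 4 := by
      rw [← dist_eq_norm, dist_comm]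
      exact (hUj _ (mem_closedBall_self zero_le_one)).le
    have hid : (fderiv ℝ (f j) x - fderiv ℝ g x) h =
        (f j (x + h) - g (x + h)) - (f j x - g x) - (f j (x + h) - f j x - fderiv ℝ (f j) x h) +
          (g (x + h) - g x - fderiv ℝ g x h) := by
      rw [sub_apply]; abel
    have h5 : ‖(fderiv ℝ (f j) x - fderiv ℝ g x) h‖ ≤
        ε * η / 4 + ε * η / 4 + C * ‖h‖ * ‖h‖ + C * ‖h‖ * ‖h‖ := by
      rw [hid]
      exact norm_add_le_of_le (norm_sub_le_of_le (norm_sub_le_of_le h3 h4) h1) h2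
    have h6 : η * ‖(fderiv ℝ (f j) x - fderiv ℝ g x) e‖ ≤ η * (ε / 2 + 2 * C * η) := by
      have hsm : ‖(fderiv ℝ (f j) x - fderiv ℝ g x) h‖ =
          η * ‖(fderiv ℝ (f j) x - fderiv ℝ g x) e‖ := by
        rw [hh, map_smul, norm_smul, Real.norm_of_nonneg hη0.le]
      rw [← hsm]
      refine h5.trans (le_of_eq ?_)
      rw [hnh]; ring
    exact le_of_mul_le_mul_left h6 hη0
  calc ‖fderiv ℝ (f j) x - fderiv ℝ g x‖ ≤ ε / 2 + 2 * C * η :=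
        ContinuousLinearMap.opNorm_le_of_unit_norm (by positivity) key
    _ < ε := by linarith

end Summit.NavierStokesRegularity.NavierStokesRegularity.Theorems.FluxZoom.Registered
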